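import Mathlib
import HarnessLib
import Summits.NavierStokesRegularity.NavierStokesRegularity.Theorems.UnthreadedRigidityDoorUnthreadedRigiditySpectralEdgeIntegralIdentity
import Literature.Analysis.FluidPDE.SphereIntegral

/-!
# Route `UnthreadedRigidityDoor`, wall item W2 `UnthreadedRigidity` (stmt-NavierStokesRegularity-27585) — LINE g13-2 «EDGE COERCIVITY»
# (ns-idea-6 g13, `EdgeCoercive_sketch.lean` v1.4 §1): ★★ INEQ_l — the sketch's `EdgeInequality l` («CRUX of this line»), every degree, VERBATIM
# (sketch-local `coerciveFunctional` / `lapSW` / `gradSq` unfolded)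

Seat ns-es-p1 g9.  `S(σ) > 0` whenever `Φ = {Y,|∇Y|²} ≢ 0` on `S²`.  By O-INT (`edgeIntegralIdentity`) `S(σ) = ∫_{S²}48𝔅_l[Y]·Φ`, by the sharp
coercivity (`edgeSharpCoercivity`) this is `≥ (12l−2)∫_{S²}Φ²`, and `∫_{S²}Φ² > 0`: POSITIVITY OF THE SPHERE INTEGRAL of the square of a continuous
homogeneous function not vanishing on `S²` (`sphereIntegral_sq_pos_of_homogeneous`) — proved through Mathlib's polar-coordinates formula
(Literature `integral_eq_integral_Ioi_sphereIntegral`): if `∫_{S²}Φ² = 0` then every sphere integral of `Φ²·g(|x|)` vanishes by homogeneity, so the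
volume integral of the continuous, compactly supported, nonnegative `Φ²·g(|x|)` (a radial bump `g` around `|x| = 3/2`) is `0`, contradicting
`Continuous.integral_pos_of_hasCompactSupport_nonneg_nonzero` at `(3/2)y₀`.  (`l = 0` is vacuous: `Φ` is then homogeneous of degree `−3`, hence `0`.)

HONEST LABEL: INEQ_l is an input of K2 of the files-only RUNG line two levels below W2; with E1_l (`edgeAngularLemma`) already in the tree this adds the
line's own formulation; nothing here bears on `UnthreadedRigidity` (27585), the door Target, W2 or Navier–Stokes regularity; no summit statement is
proved.  0 kit.  [folklore]
-/

noncomputable section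

-- the summit and its single sub-problem share the name (CONVENTIONS §1), as in every Theorems file
set_option linter.dupNamespace false

namespace Summit.NavierStokesRegularity.NavierStokesRegularity.Theorems.UnthreadedRigidity.SpectralEdge

open Set Function Filter Topology MeasureTheory Metric
open scoped RealInnerProductSpace ContDiff
open Literature.Analysis.FluidPDE (sphereIntegral sphereIntegral_def integral_eq_integral_Ioi_sphereIntegral)
open Literature.Analysis.Calculus (sphereIntegral_nonneg')
open Summit.NavierStokesRegularity.NavierStokesRegularity.Theorems.UnthreadedRigidity.ProfileHorn (E3)
open Summit.NavierStokesRegularity.NavierStokesRegularity.Theorems.UnthreadedRigidity.VirialHorn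

/-! ## §1 Positivity of `∫_{S²} Φ²` for a homogeneous `Φ ≢ 0` on `S²` -/

/-- homogeneity of the sphere integrals of `g(|x|)·Φ(x)²`: `∮_{S_r} g(|x|)Φ² = g(r)·r^{2m}·∮_{S_1} Φ²` (`r > 0`). -/
theorem sphereIntegral_radial_mul_sq {Φ : E3 → ℝ} (m : ℤ) (hhom : ∀ c : ℝ, 0 < c → ∀ z : E3, Φ (c • z) = c ^ m • Φ z)
    (g : ℝ → ℝ) {r : ℝ} (hr : 0 < r) :
    sphereIntegral (volume : Measure E3) (fun x => g ‖x‖ * Φ x ^ 2) r =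
      g r * (r ^ m) ^ 2 * sphereIntegral (volume : Measure E3) (fun x => Φ x ^ 2) 1 := by
  rw [sphereIntegral_def, sphereIntegral_def, ← integral_const_mul]
  refine integral_congr_ae (ae_of_all _ fun α => ?_)
  have hα : ‖(α : E3)‖ = 1 := by simp
  simp only [one_smul, norm_smul, Real.norm_eq_abs, abs_of_pos hr, hα, mul_one, hhom r hr, smul_eq_mul]
  ring

/-- ★ POSITIVITY: a continuous `Φ`, homogeneous of integer degree `m`, with `Φ(y₀) ≠ 0` at some point of the unit sphere, has `∫_{S²} Φ² > 0`
(polar coordinates + positivity of the volume integral of a continuous compactly supported nonnegative nonzero function). [folklore] -/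
theorem sphereIntegral_sq_pos_of_homogeneous {Φ : E3 → ℝ} (hΦ : Continuous Φ) (m : ℤ)
    (hhom : ∀ c : ℝ, 0 < c → ∀ z : E3, Φ (c • z) = c ^ m • Φ z) {y₀ : E3} (hy₀ : ‖y₀‖ = 1) (hne : Φ y₀ ≠ 0) :
    0 < sphereIntegral (volume : Measure E3) (fun x => Φ x ^ 2) 1 := by
  have hnn : 0 ≤ sphereIntegral (volume : Measure E3) (fun x => Φ x ^ 2) 1 := sphereIntegral_nonneg' (fun x => sq_nonneg _) 1
  rcases hnn.lt_or_eq with hpos | hzero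
  · exact hpos
  exfalso
  -- the radial bump `g` around `|x| = 3/2`
  set g : ℝ → ℝ := fun r => max 0 (1 - 16 * (r - 3 / 2) ^ 2) with hg
  have hgc : Continuous g := continuous_const.max (continuous_const.sub (continuous_const.mul ((continuous_id.sub continuous_const).pow 2)))
  have hg0 : ∀ r, 0 ≤ g r := fun r => le_max_left _ _
  have hgz : ∀ r, 2 ≤ r → g r = 0 := by
    intro r hr2
    rw [hg]
    refine max_eq_left ?_
    nlinarith
  -- the test function
  set F : E3 → ℝ := fun x => g ‖x‖ * Φ x ^ 2 with hF
  have hFc : Continuous F := (hgc.comp continuous_norm).mul (hΦ.pow 2)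
  have hFnn : 0 ≤ F := fun x => mul_nonneg (hg0 _) (sq_nonneg _)
  have hFsupp : HasCompactSupport F := by
    refine HasCompactSupport.intro (isCompact_closedBall (0 : E3) 2) fun x hx => ?_
    have hx2 : 2 ≤ ‖x‖ := by
      rw [mem_closedBall, dist_zero_right, not_le] at hx
      exact hx.le
    show g ‖x‖ * Φ x ^ 2 = 0
    rw [hgz _ hx2, zero_mul]
  -- it does not vanish at `(3/2) y₀`
  have hFne : F (((3 : ℝ) / 2) • y₀) ≠ 0 := by
    show g ‖((3 : ℝ) / 2) • y₀‖ * Φ (((3 : ℝ) / 2) • y₀) ^ 2 ≠ 0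
    have h32 : (0 : ℝ) < 3 / 2 := by norm_num
    rw [norm_smul, Real.norm_eq_abs, abs_of_pos h32, hy₀, mul_one, hhom _ h32 y₀, smul_eq_mul]
    have hg1 : g (3 / 2) = 1 := by rw [hg]; norm_num
    rw [hg1, one_mul]
    exact pow_ne_zero 2 (mul_ne_zero (zpow_ne_zero m h32.ne') hne)
  have hFpos : 0 < ∫ x, F x ∂(volume : Measure E3) := hFc.integral_pos_of_hasCompactSupport_nonneg_nonzero hFsupp hFnn hFne
  -- but by polar coordinates all its sphere integrals vanish
  have hpolar := integral_eq_integral_Ioi_sphereIntegral (volume : Measure E3) (hFc.integrable_of_hasCompactSupport hFsupp)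
  have hsph : ∀ r ∈ Ioi (0 : ℝ), (r ^ (Module.finrank ℝ E3 - 1)) • sphereIntegral (volume : Measure E3) F r = 0 := by
    intro r hr
    have h := sphereIntegral_radial_mul_sq m hhom g (mem_Ioi.1 hr)
    rw [show sphereIntegral (volume : Measure E3) F r = sphereIntegral (volume : Measure E3) (fun x => g ‖x‖ * Φ x ^ 2) r from rfl, h,
      ← hzero, mul_zero, smul_zero]
  rw [hpolar, setIntegral_congr_fun measurableSet_Ioi hsph, integral_zero] at hFpos
  exact lt_irrefl _ hFpos

/-! ## §2 ★★ `EdgeInequality l`, VERBATIM, every degree -/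

/-- ★★ **INEQ_l — the sketch's `EdgeInequality l` VERBATIM** (sketch-local `coerciveFunctional` / `lapSW` / `gradSq` unfolded), every degree `l`:
the coercive functional `S(σ)` is strictly positive as soon as `{Y,|∇Y|²}` does not vanish identically on the unit sphere
(`edgeIntegralIdentity` + `edgeSharpCoercivity` + `sphereIntegral_sq_pos_of_homogeneous`; `l = 0` is vacuous). -/
theorem edgeInequality (l : ℕ) :
    ∀ Y : E3 → ℝ, IsSolidHarmonic l Y → (∃ y : E3, ‖y‖ = 1 ∧ angForm Y y ≠ 0) →
      0 < sphereIntegral (volume : Measure E3)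
          (fun y => pbr Y (fun y : E3 => lap3 (fun z : E3 => ‖gradient Y z‖ ^ 2) y
              - (2 * (l : ℝ) - 2) * (2 * (l : ℝ) - 1) * ‖gradient Y y‖ ^ 2
              - (l : ℝ) ^ 2 * (lap3 (fun z : E3 => Y z ^ 2) y - 2 * (l : ℝ) * (2 * (l : ℝ) + 1) * Y y ^ 2)) y * angForm Y y
            + 6 * ((l : ℝ) * ((l : ℝ) + 1)) * angForm Y y ^ 2) 1 := by
  intro Y hY hex
  obtain ⟨y₀, hy₀, hne⟩ := hex
  have hΦc : Continuous (angForm Y) := (ThreadingJets.contDiff_angForm hY).continuous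
  have hhom : ∀ c : ℝ, 0 < c → ∀ z : E3, angForm Y (c • z) = c ^ ((3 * l : ℤ) - 3) • angForm Y z := ThreadingJets.angForm_smul' hY
  rcases Nat.eq_zero_or_pos l with hl | hl
  · -- `l = 0`: `Φ` is homogeneous of degree `−3`, hence `0` — the hypothesis is contradictory
    subst hl
    exact absurd (eq_zero_of_homogeneous_neg hΦc.continuousAt _ (by norm_num) hhom y₀) hne
  · rw [← edgeIntegralIdentity l Y hY]
    have hS := edgeSharpCoercivity l Y hY
    have hP := sphereIntegral_sq_pos_of_homogeneous hΦc _ hhom hy₀ hne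
    have hc : (0 : ℝ) < 12 * (l : ℝ) - 2 := by
      have : (1 : ℝ) ≤ (l : ℝ) := by exact_mod_cast hl
      linarith
    exact lt_of_lt_of_le (mul_pos hc hP) hS

end Summit.NavierStokesRegularity.NavierStokesRegularity.Theorems.UnthreadedRigidity.SpectralEdge

end
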